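import Mathlib
import HarnessLib
import Summits.Ventures.LatticeQCDFlow.Scoring.SplitChainPathLaw

/-!
# The tower and regeneration identities for path functionals that DEPEND ONLY ON THE PAST
# (`DependsOn G (Set.Iic b)`): the bookkeeping-free form used by the gap / block arguments

HONEST FRAMING: exact (Metropolis-corrected) sampling algorithms for lattice gauge theory;
figures of merit are autocorrelation/cost numbers at stated couplings and volumes; no
continuum-physics claim.

Venture `LatticeQCDFlow` (cell pub-lqcd), topic `Scoring`; FANOUT row 8 (`s0-cpn-nemc`, GEN-15).
NEW WORK of the cell, not a published result; no definition is introduced.  The tower property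
(`Scoring/ChainTimeAverage.chain_tower`, `Scoring/ChainPathLaw.chain_tower_iterate`) and the
regeneration identities of the split chain (`Scoring/SplitChain.lean`,
`Scoring/SplitChainPathLaw.lean`) are stated for functionals `F ∘ frestrictLe b` of the restricted
history `(Iic b → state)`.  Arguments about gaps and blocks manipulate products and sums of many such
functionals, for which the restriction bookkeeping is heavy; this file restates everything for
functionals `G` of the WHOLE path that merely do not depend on coordinates after time `b` — Mathlib's
`DependsOn G (Set.Iic b)` — by padding a restricted history to a path (no definition: the padding
map is written inline).  Nothing is cited; no printed counterpart beyond those of the parent files.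

## Content (`κ` Markov on a measurable space `S`, `P_{μ₀,κ}` its chain law; `G` bounded measurable
## with `DependsOn G (Set.Iic b)`; for the split-chain items the notation of `Scoring/SplitChain.lean`)

* `measurable_padIic`, `dependsOn_eq_comp_padIic` — padding a history up to time `b` to a path by
  repeating the last state is measurable, and `G = (G ∘ pad) ∘ frestrictLe b` when
  `DependsOn G (Set.Iic b)`;
* **`chain_tower_dependsOn`**, **`chain_tower_iterate_dependsOn`** —
  `E[G(X) g(X_{b+t})] = E[G(X) ((kop κ)^[t] g)(X_b)]`;
* **`splitChain_regeneration_dependsOn`**, `splitChain_coin_dependsOn`,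
  **`splitChain_tails_dependsOn`** — `E[G · 1{coin_{b+1}} g(X_{b+1})] = ε ν(g) E[G]`,
  `E[G · 1{coin_{b+1}}] = ε E[G]`, `E[G · 1{coin_{b+1} = tails}] = (1 − ε) E[G]`;
* **`splitChain_regeneration_integral_dependsOn`** — for `G ≥ 0` and a bounded measurable path
  functional `H`: `E[G · 1{coin_{b+1}} · H(θ_{b+1} X̂)] = ε E[G] E_{P̂_{ν ⊗ δ_true}}[H]`;
  **`splitChain_regeneration_stateIntegral_dependsOn`** — the same with `H` a functional of the
  STATE path: `E[G · 1{coin_{b+1}} · H((X_{b+1+n})_n)] = ε E[G] E_{P_{ν,κ}}[H]`.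

NOT CLAIMED: anything beyond the parent files' content; this is their `DependsOn` interface.
-/

noncomputable section

namespace Summit.Ventures.LatticeQCDFlow.Scoring

open MeasureTheory ProbabilityTheory Filter Finset Preorder Literature.Probability.MarkovChains
open scoped ENNReal

/-! ### Padding a finite history to a path -/

section Pad

variable {S : Type*} [MeasurableSpace S]

/-- Padding a history up to time `b` to a path (repeat the last state) is measurable. -/
theorem measurable_padIic (b : ℕ) :
    Measurable (fun (h : (i : ↥(Finset.Iic b)) → S) (n : ℕ) =>
      if hn : n ≤ b then h ⟨n, Finset.mem_Iic.2 hn⟩ else h ⟨b, Finset.mem_Iic.2 le_rfl⟩) := by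
  refine measurable_pi_lambda _ fun n => ?_
  by_cases hn : n ≤ b
  · simp only [hn, dif_pos]; exact measurable_pi_apply _
  · simp only [hn, dif_neg, not_false_eq_true]; exact measurable_pi_apply _

omit [MeasurableSpace S] in
/-- A functional that depends only on times `≤ b` factors through the restricted history:
`G x = G (pad (x_{≤b}))` (written beta-reduced). -/
theorem dependsOn_eq_comp_padIic (b : ℕ) {β : Type*} {G : (ℕ → S) → β}
    (hGd : DependsOn G (Set.Iic b)) (x : ℕ → S) :
    G x = G (fun n : ℕ => if hn : n ≤ b then frestrictLe b x ⟨n, Finset.mem_Iic.2 hn⟩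
      else frestrictLe b x ⟨b, Finset.mem_Iic.2 le_rfl⟩) := by
  refine hGd fun i hi => ?_
  have hi' : i ≤ b := Set.mem_Iic.1 hi
  simp only [hi', dif_pos]
  rfl

end Pad

/-! ### The tower property for `DependsOn` functionals -/

section Tower

variable {S : Type*} [MeasurableSpace S]
  (κ : Kernel S S) [IsMarkovKernel κ] (μ₀ : Measure S) [IsProbabilityMeasure μ₀]

/-- **Tower property, `DependsOn` form**: `E[G(X) g(X_{b+1})] = E[G(X) (kop κ g)(X_b)]` for bounded
measurable `G` with `DependsOn G (Set.Iic b)`. -/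
theorem chain_tower_dependsOn (b : ℕ) {G : (ℕ → S) → ℝ} (hG : Measurable G)
    (hGd : DependsOn G (Set.Iic b)) {CG : ℝ} (hCG : ∀ x, |G x| ≤ CG) {g : S → ℝ} (hg : Measurable g)
    {Cg : ℝ} (hCg : ∀ x, |g x| ≤ Cg) :
    ∫ x, G x * g (x (b + 1)) ∂(Kernel.trajMeasure (X := fun _ : ℕ => S) μ₀
        (fun n : ℕ => κ.comap (fun h : (i : ↥(Finset.Iic n)) → S => h ⟨n, Finset.mem_Iic.2 le_rfl⟩)
          (measurable_pi_apply _)))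
      = ∫ x, G x * kop κ g (x b) ∂(Kernel.trajMeasure (X := fun _ : ℕ => S) μ₀
        (fun n : ℕ => κ.comap (fun h : (i : ↥(Finset.Iic n)) → S => h ⟨n, Finset.mem_Iic.2 le_rfl⟩)
          (measurable_pi_apply _))) := by
  have hfac := dependsOn_eq_comp_padIic b hGd
  have key := chain_tower κ μ₀ b (F := G ∘ fun (h : (i : ↥(Finset.Iic b)) → S) (n : ℕ) =>
      if hn : n ≤ b then h ⟨n, Finset.mem_Iic.2 hn⟩ else h ⟨b, Finset.mem_Iic.2 le_rfl⟩)
    (hG.comp (measurable_padIic b)) (fun h => hCG _) hg hCg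
  simp only [Function.comp_apply] at key
  calc ∫ x, G x * g (x (b + 1)) ∂(Kernel.trajMeasure (X := fun _ : ℕ => S) μ₀
        (fun n : ℕ => κ.comap (fun h : (i : ↥(Finset.Iic n)) → S => h ⟨n, Finset.mem_Iic.2 le_rfl⟩)
          (measurable_pi_apply _)))
      = _ := (integral_congr_ae (ae_of_all _ fun x => by rw [← hfac x])).trans key
    _ = _ := integral_congr_ae (ae_of_all _ fun x => by beta_reduce; rw [← hfac x])

/-- **`t`-step tower property, `DependsOn` form**:
`E[G(X) g(X_{b+t})] = E[G(X) ((kop κ)^[t] g)(X_b)]`. -/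
theorem chain_tower_iterate_dependsOn (b t : ℕ) {G : (ℕ → S) → ℝ} (hG : Measurable G)
    (hGd : DependsOn G (Set.Iic b)) {CG : ℝ} (hCG : ∀ x, |G x| ≤ CG) {g : S → ℝ} (hg : Measurable g)
    {Cg : ℝ} (hCg : ∀ x, |g x| ≤ Cg) :
    ∫ x, G x * g (x (b + t)) ∂(Kernel.trajMeasure (X := fun _ : ℕ => S) μ₀
        (fun n : ℕ => κ.comap (fun h : (i : ↥(Finset.Iic n)) → S => h ⟨n, Finset.mem_Iic.2 le_rfl⟩)
          (measurable_pi_apply _)))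
      = ∫ x, G x * (kop κ)^[t] g (x b) ∂(Kernel.trajMeasure (X := fun _ : ℕ => S) μ₀
        (fun n : ℕ => κ.comap (fun h : (i : ↥(Finset.Iic n)) → S => h ⟨n, Finset.mem_Iic.2 le_rfl⟩)
          (measurable_pi_apply _))) := by
  have hfac := dependsOn_eq_comp_padIic b hGd
  have key := chain_tower_iterate κ μ₀ b (F := G ∘ fun (h : (i : ↥(Finset.Iic b)) → S) (n : ℕ) =>
      if hn : n ≤ b then h ⟨n, Finset.mem_Iic.2 hn⟩ else h ⟨b, Finset.mem_Iic.2 le_rfl⟩)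
    (hG.comp (measurable_padIic b)) (fun h => hCG _) t hg hCg
  simp only [Function.comp_apply] at key
  calc ∫ x, G x * g (x (b + t)) ∂(Kernel.trajMeasure (X := fun _ : ℕ => S) μ₀
        (fun n : ℕ => κ.comap (fun h : (i : ↥(Finset.Iic n)) → S => h ⟨n, Finset.mem_Iic.2 le_rfl⟩)
          (measurable_pi_apply _)))
      = _ := (integral_congr_ae (ae_of_all _ fun x => by rw [← hfac x])).trans key
    _ = _ := integral_congr_ae (ae_of_all _ fun x => by beta_reduce; rw [← hfac x])

end Tower

/-! ### The split chain's identities for `DependsOn` functionals -/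

section Split

variable {Ω : Type*} [MeasurableSpace Ω]
  {κ : Kernel Ω Ω} [IsMarkovKernel κ] {ν : Measure Ω} [IsProbabilityMeasure ν] {ε : ℝ≥0∞}
  {hmin : ∀ x {B : Set Ω}, MeasurableSet B → ε * ν B ≤ κ x B}
  (κs : Kernel (Ω × Bool) (Ω × Bool)) [IsMarkovKernel κs]
  (μs : Measure (Ω × Bool)) [IsProbabilityMeasure μs]

/-- **Regeneration at the next step, `DependsOn` form**:
`E[G(X̂) · 1{coin_{b+1}} g(X_{b+1})] = ε ν(g) E[G(X̂)]`. -/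
theorem splitChain_regeneration_dependsOn (hε : ε < 1)
    (hκs : ∀ p, κs p = (ε • ν).map (fun y : Ω => (y, true))
      + ((1 - ε) • Doeblin.residualKernel κ ν ε hmin p.1).map (fun y : Ω => (y, false)))
    (b : ℕ) {G : (ℕ → Ω × Bool) → ℝ} (hG : Measurable G) (hGd : DependsOn G (Set.Iic b))
    {CG : ℝ} (hCG : ∀ x, |G x| ≤ CG) {g : Ω → ℝ} (hg : Measurable g) {Cg : ℝ}
    (hCg : ∀ x, |g x| ≤ Cg) :
    ∫ x, G x * (if (x (b + 1)).2 then g (x (b + 1)).1 else 0)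
        ∂(Kernel.trajMeasure (X := fun _ : ℕ => Ω × Bool) μs
          (fun n : ℕ => κs.comap (fun h : (i : ↥(Finset.Iic n)) → Ω × Bool =>
            h ⟨n, Finset.mem_Iic.2 le_rfl⟩) (measurable_pi_apply _)))
      = ε.toReal * (∫ y, g y ∂ν) * ∫ x, G x
        ∂(Kernel.trajMeasure (X := fun _ : ℕ => Ω × Bool) μs
          (fun n : ℕ => κs.comap (fun h : (i : ↥(Finset.Iic n)) → Ω × Bool =>
            h ⟨n, Finset.mem_Iic.2 le_rfl⟩) (measurable_pi_apply _))) := by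
  have hfac := dependsOn_eq_comp_padIic b hGd
  have key := splitChain_regeneration κs μs (κ := κ) (ν := ν) (hmin := hmin) hε hκs b
    (F := G ∘ fun (h : (i : ↥(Finset.Iic b)) → Ω × Bool) (n : ℕ) =>
      if hn : n ≤ b then h ⟨n, Finset.mem_Iic.2 hn⟩ else h ⟨b, Finset.mem_Iic.2 le_rfl⟩)
    (hG.comp (measurable_padIic b)) (fun h => hCG _) hg hCg
  simp only [Function.comp_apply] at key
  calc ∫ x, G x * (if (x (b + 1)).2 then g (x (b + 1)).1 else 0)
        ∂(Kernel.trajMeasure (X := fun _ : ℕ => Ω × Bool) μs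
          (fun n : ℕ => κs.comap (fun h : (i : ↥(Finset.Iic n)) → Ω × Bool =>
            h ⟨n, Finset.mem_Iic.2 le_rfl⟩) (measurable_pi_apply _)))
      = _ := (integral_congr_ae (ae_of_all _ fun x => by rw [← hfac x])).trans key
    _ = _ := by
      congr 1
      exact integral_congr_ae (ae_of_all _ fun x => by beta_reduce; rw [← hfac x])

/-- **The coin at the next step, `DependsOn` form**: `E[G(X̂) · 1{coin_{b+1}}] = ε E[G(X̂)]`. -/
theorem splitChain_coin_dependsOn (hε : ε < 1)
    (hκs : ∀ p, κs p = (ε • ν).map (fun y : Ω => (y, true))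
      + ((1 - ε) • Doeblin.residualKernel κ ν ε hmin p.1).map (fun y : Ω => (y, false)))
    (b : ℕ) {G : (ℕ → Ω × Bool) → ℝ} (hG : Measurable G) (hGd : DependsOn G (Set.Iic b))
    {CG : ℝ} (hCG : ∀ x, |G x| ≤ CG) :
    ∫ x, G x * (if (x (b + 1)).2 then (1 : ℝ) else 0)
        ∂(Kernel.trajMeasure (X := fun _ : ℕ => Ω × Bool) μs
          (fun n : ℕ => κs.comap (fun h : (i : ↥(Finset.Iic n)) → Ω × Bool =>
            h ⟨n, Finset.mem_Iic.2 le_rfl⟩) (measurable_pi_apply _)))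
      = ε.toReal * ∫ x, G x
        ∂(Kernel.trajMeasure (X := fun _ : ℕ => Ω × Bool) μs
          (fun n : ℕ => κs.comap (fun h : (i : ↥(Finset.Iic n)) → Ω × Bool =>
            h ⟨n, Finset.mem_Iic.2 le_rfl⟩) (measurable_pi_apply _))) := by
  have h := splitChain_regeneration_dependsOn κs μs (κ := κ) (ν := ν) (hmin := hmin) hε hκs b hG
    hGd hCG (g := fun _ => (1 : ℝ)) measurable_const (Cg := 1) (fun _ => by simp)
  rw [integral_const, probReal_univ, one_smul, mul_one] at h
  exact h

/-- **Tails at the next step, `DependsOn` form**: `E[G(X̂) · 1{coin_{b+1} = tails}] = (1 − ε) E[G(X̂)]`. -/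
theorem splitChain_tails_dependsOn (hε : ε < 1)
    (hκs : ∀ p, κs p = (ε • ν).map (fun y : Ω => (y, true))
      + ((1 - ε) • Doeblin.residualKernel κ ν ε hmin p.1).map (fun y : Ω => (y, false)))
    (b : ℕ) {G : (ℕ → Ω × Bool) → ℝ} (hG : Measurable G) (hGd : DependsOn G (Set.Iic b))
    {CG : ℝ} (hCG : ∀ x, |G x| ≤ CG) :
    ∫ x, G x * (if (x (b + 1)).2 then (0 : ℝ) else 1)
        ∂(Kernel.trajMeasure (X := fun _ : ℕ => Ω × Bool) μs
          (fun n : ℕ => κs.comap (fun h : (i : ↥(Finset.Iic n)) → Ω × Bool =>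
            h ⟨n, Finset.mem_Iic.2 le_rfl⟩) (measurable_pi_apply _)))
      = (1 - ε.toReal) * ∫ x, G x
        ∂(Kernel.trajMeasure (X := fun _ : ℕ => Ω × Bool) μs
          (fun n : ℕ => κs.comap (fun h : (i : ↥(Finset.Iic n)) → Ω × Bool =>
            h ⟨n, Finset.mem_Iic.2 le_rfl⟩) (measurable_pi_apply _))) := by
  set P := Kernel.trajMeasure (X := fun _ : ℕ => Ω × Bool) μs
      (fun n : ℕ => κs.comap (fun h : (i : ↥(Finset.Iic n)) → Ω × Bool =>
        h ⟨n, Finset.mem_Iic.2 le_rfl⟩) (measurable_pi_apply _)) with hP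
  have hcoin := splitChain_coin_dependsOn κs μs (κ := κ) (ν := ν) (hmin := hmin) hε hκs b hG hGd
    hCG
  rw [← hP] at hcoin
  have hheads : Measurable fun x : ℕ → Ω × Bool => (if (x (b + 1)).2 then (1 : ℝ) else 0) := by
    refine Measurable.ite ?_ measurable_const measurable_const
    exact (measurable_snd.comp (measurable_pi_apply _)) (measurableSet_singleton true)
  have hGi : Integrable G P := integrable_of_bounded P hG hCG
  have hGhi : Integrable (fun x => G x * (if (x (b + 1)).2 then (1 : ℝ) else 0)) P := by
    refine integrable_of_bounded P (hG.mul hheads) (C := CG * 1) fun x => ?_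
    rw [abs_mul]
    refine mul_le_mul (hCG x) ?_ (abs_nonneg _) ((abs_nonneg _).trans (hCG x))
    split_ifs <;> simp
  have hpt : ∀ x : ℕ → Ω × Bool, G x * (if (x (b + 1)).2 then (0 : ℝ) else 1)
      = G x - G x * (if (x (b + 1)).2 then (1 : ℝ) else 0) := fun x => by
    split_ifs <;> ring
  simp_rw [hpt]
  rw [integral_sub hGi hGhi, hcoin]
  ring

/-- **Regeneration of the future path, `DependsOn` form**: for `G ≥ 0` bounded measurable with
`DependsOn G (Set.Iic b)` and a bounded measurable path functional `H`:
`E[G(X̂) · 1{coin_{b+1}} · H(θ_{b+1} X̂)] = ε · E[G(X̂)] · E_{P̂_{ν ⊗ δ_true}}[H]`. -/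
theorem splitChain_regeneration_integral_dependsOn (hε : ε < 1)
    (hκs : ∀ p, κs p = (ε • ν).map (fun y : Ω => (y, true))
      + ((1 - ε) • Doeblin.residualKernel κ ν ε hmin p.1).map (fun y : Ω => (y, false)))
    (b : ℕ) {G : (ℕ → Ω × Bool) → ℝ} (hG : Measurable G) (hGd : DependsOn G (Set.Iic b))
    {CG : ℝ} (hCG : ∀ x, |G x| ≤ CG) (hG0 : ∀ x, 0 ≤ G x) {H : (ℕ → Ω × Bool) → ℝ}
    (hH : Measurable H) :
    ∫ x, G x * (if (x (b + 1)).2 then (1 : ℝ) else 0) * H (fun n => x (b + 1 + n))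
        ∂(Kernel.trajMeasure (X := fun _ : ℕ => Ω × Bool) μs
          (fun n : ℕ => κs.comap (fun h : (i : ↥(Finset.Iic n)) → Ω × Bool =>
            h ⟨n, Finset.mem_Iic.2 le_rfl⟩) (measurable_pi_apply _)))
      = ε.toReal * (∫ x, G x
          ∂(Kernel.trajMeasure (X := fun _ : ℕ => Ω × Bool) μs
            (fun n : ℕ => κs.comap (fun h : (i : ↥(Finset.Iic n)) → Ω × Bool =>
              h ⟨n, Finset.mem_Iic.2 le_rfl⟩) (measurable_pi_apply _))))
        * ∫ y, H y ∂(Kernel.trajMeasure (X := fun _ : ℕ => Ω × Bool) (ν.map (fun y : Ω => (y, true)))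
          (fun n : ℕ => κs.comap (fun h : (i : ↥(Finset.Iic n)) → Ω × Bool =>
            h ⟨n, Finset.mem_Iic.2 le_rfl⟩) (measurable_pi_apply _))) := by
  have hfac := dependsOn_eq_comp_padIic b hGd
  have key := splitChain_regeneration_integral κs μs (κ := κ) (ν := ν) (hmin := hmin) hε hκs b
    (F := G ∘ fun (h : (i : ↥(Finset.Iic b)) → Ω × Bool) (n : ℕ) =>
      if hn : n ≤ b then h ⟨n, Finset.mem_Iic.2 hn⟩ else h ⟨b, Finset.mem_Iic.2 le_rfl⟩)
    (hG.comp (measurable_padIic b)) (fun h => hCG _) (fun h => hG0 _) hH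
  simp only [Function.comp_apply] at key
  calc ∫ x, G x * (if (x (b + 1)).2 then (1 : ℝ) else 0) * H (fun n => x (b + 1 + n))
        ∂(Kernel.trajMeasure (X := fun _ : ℕ => Ω × Bool) μs
          (fun n : ℕ => κs.comap (fun h : (i : ↥(Finset.Iic n)) → Ω × Bool =>
            h ⟨n, Finset.mem_Iic.2 le_rfl⟩) (measurable_pi_apply _)))
      = _ := (integral_congr_ae (ae_of_all _ fun x => by rw [← hfac x])).trans key
    _ = _ := by
      congr 2
      exact integral_congr_ae (ae_of_all _ fun x => by beta_reduce; rw [← hfac x])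

/-- **Regeneration of the future STATE path, `DependsOn` form**: for `G ≥ 0` as above and a
bounded measurable functional `H` of a state path:
`E[G(X̂) · 1{coin_{b+1}} · H((X_{b+1+n})_n)] = ε · E[G(X̂)] · E_{P_{ν,κ}}[H]` — after a head the
states are a fresh `κ`-chain from `ν`, whatever the (weighted) past. -/
theorem splitChain_regeneration_stateIntegral_dependsOn (hε : ε < 1)
    (hκs : ∀ p, κs p = (ε • ν).map (fun y : Ω => (y, true))
      + ((1 - ε) • Doeblin.residualKernel κ ν ε hmin p.1).map (fun y : Ω => (y, false)))
    (b : ℕ) {G : (ℕ → Ω × Bool) → ℝ} (hG : Measurable G) (hGd : DependsOn G (Set.Iic b))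
    {CG : ℝ} (hCG : ∀ x, |G x| ≤ CG) (hG0 : ∀ x, 0 ≤ G x) {H : (ℕ → Ω) → ℝ}
    (hH : Measurable H) :
    ∫ x, G x * (if (x (b + 1)).2 then (1 : ℝ) else 0) * H (fun n => (x (b + 1 + n)).1)
        ∂(Kernel.trajMeasure (X := fun _ : ℕ => Ω × Bool) μs
          (fun n : ℕ => κs.comap (fun h : (i : ↥(Finset.Iic n)) → Ω × Bool =>
            h ⟨n, Finset.mem_Iic.2 le_rfl⟩) (measurable_pi_apply _)))
      = ε.toReal * (∫ x, G x
          ∂(Kernel.trajMeasure (X := fun _ : ℕ => Ω × Bool) μs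
            (fun n : ℕ => κs.comap (fun h : (i : ↥(Finset.Iic n)) → Ω × Bool =>
              h ⟨n, Finset.mem_Iic.2 le_rfl⟩) (measurable_pi_apply _))))
        * ∫ y, H y ∂(Kernel.trajMeasure (X := fun _ : ℕ => Ω) ν
          (fun n : ℕ => κ.comap (fun h : (i : ↥(Finset.Iic n)) → Ω => h ⟨n, Finset.mem_Iic.2 le_rfl⟩)
            (measurable_pi_apply _))) := by
  haveI hνt : IsProbabilityMeasure (ν.map (fun y : Ω => (y, true))) :=
    Measure.isProbabilityMeasure_map (measurable_tagCoin true).aemeasurable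
  have hfst : Measurable (fun (x : ℕ → Ω × Bool) (n : ℕ) => (x n).1) :=
    measurable_pi_lambda _ fun n => measurable_fst.comp (measurable_pi_apply _)
  have h := splitChain_regeneration_integral_dependsOn κs μs (κ := κ) (ν := ν) (hmin := hmin) hε hκs
    b hG hGd hCG hG0 (H := H ∘ fun (x : ℕ → Ω × Bool) (n : ℕ) => (x n).1) (hH.comp hfst)
  simp only [Function.comp_apply] at h
  rw [h, ← integral_map hfst.aemeasurable hH.aestronglyMeasurable,
    splitChain_map_fst κs _ (κ := κ) (ν := ν) (hmin := hmin) hε hκs,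
    Measure.map_map measurable_fst (measurable_tagCoin true)]
  have : Prod.fst ∘ (fun y : Ω => (y, true)) = id := rfl
  rw [this, Measure.map_id]

end Split

end Summit.Ventures.LatticeQCDFlow.Scoring

end
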